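import Summits.Ventures.Crystal3D.Theorems.StickyWulffConstantGenericWallFloorShellRowCertDefs
import HarnessLib

/-!
# Lane G's two-centre SHELL ROW, part 2: analytic lemmas of the sphere-covering certificate (crux `GenericWallFloor`, line `WallLedgerG`)

HONEST FRAMING. Venture `Summits/Ventures/Crystal3D` (cell `crystal3d-full`), helper `--supports` the crux
`GenericWallFloor` (stmt-Ventures-19480) of `route-Ventures-StickyWulffConstant`, REGISTERED line `WallLedgerG`, open
stub `stub_twoSlabAdhesion`.  Rung credit only; F-C1 not moved; NOT the stub.  AUTHORSHIP: written by the cell's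
certified-computation planner cf-p2 g18 (PREREG §43, HOME/cf-p2/gtwo/bridge/ShellRowCertFull.lean, kit j314276, 0 sorries)
and landed verbatim (split into tree-sized files, docstrings added) by 19480-p1 g9 on cf-p1's instruction §86(94)/(100).
THE OBJECT (PREREG-G-TWOCENTRE, 19480-p1 g8; vocabulary `…GenericWallFloorShellRowDefs`, p653220): the TWO-CENTRE SHELL ROW of
lane G — a ball `z` of a unit packing CARRYING a shell class (its contacts and its non-contact neighbours within `√(8/3)` at the
listed relative cubic positions) has at most `bound` contacts (`ShellRowHolds`).  Certificate: the unit sphere about `z` is covered by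
the open unit balls about the listed points (so any further touching ball would overlap one of them), checked on a cube-map grid of
`6N²` cells by an exact integer inequality per cell (`shellCellCovered`; radial-projection Lipschitz bound `natSqrtCeil`).

This file: the cubic-coordinate isometry lemmas (`ofCubic`), the radial-projection estimate `norm_sub_le_norm_smul_sub_smul`, the per-cell
covering lemma `norm_sub_pointVec_lt_one` (a passing integer cell test ⇒ every unit vector whose cube-map image lies in the cell is within
distance `< 1` of the listed point), and the cube-map bookkeeping (`cellIdx`, `abs_sub_cellCentre_le`, …).
WHAT THIS IS NOT: not the stub; no statement about which packings carry the classes (that is the coverage glue); F-C1 not moved.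
-/

noncomputable section

namespace Summit.Ventures.Crystal3D.Theorems

open Finset
open scoped InnerProductSpace RealInnerProductSpace

/-- Cubic coordinates of `ofCubic v` are `v`. -/
theorem cubicCoords_ofCubic (v : Fin 3 → ℝ) : cubicCoords (ofCubic v) = v := by
  simp only [ofCubic, Fin.sum_univ_three, cubicCoords_add, cubicCoords_smul, cubicCoords_cubicFrame]
  ext i; fin_cases i <;> simp

/-- `cubicVecQ` through `ofCubic`. -/
theorem cubicVecQ_eq_ofCubic (q : Fin 3 → ℚ) : cubicVecQ q = ofCubic fun i => ((q i : ℚ) : ℝ) / Real.sqrt 2 := rfl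

/-- `ofCubic` is isometric: inner products become dot products. -/
theorem inner_ofCubic (v w : Fin 3 → ℝ) : ⟪ofCubic v, ofCubic w⟫_ℝ = v ⬝ᵥ w := by
  rw [inner_eq_cubicCoords, cubicCoords_ofCubic, cubicCoords_ofCubic]

/-- `ofCubic` is isometric: norms. -/
theorem norm_sq_ofCubic (v : Fin 3 → ℝ) : ‖ofCubic v‖ ^ 2 = v ⬝ᵥ v := by
  rw [norm_sq_eq_cubicCoords, cubicCoords_ofCubic]

/-- `ofCubic` inverts `cubicCoords`. -/
theorem ofCubic_cubicCoords (x : (EuclideanSpace ℝ (Fin 3))) : ofCubic (cubicCoords x) = x :=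
  cubicCoords_injective (cubicCoords_ofCubic _)

/-- `ofCubic` is homogeneous. -/
theorem ofCubic_smul (r : ℝ) (v : Fin 3 → ℝ) : ofCubic (r • v) = r • ofCubic v := by
  apply cubicCoords_injective; rw [cubicCoords_ofCubic, cubicCoords_smul, cubicCoords_ofCubic]

/-- `ofCubic` is additive (differences). -/
theorem ofCubic_sub (v w : Fin 3 → ℝ) : ofCubic (v - w) = ofCubic v - ofCubic w := by
  apply cubicCoords_injective; rw [cubicCoords_ofCubic, cubicCoords_sub, cubicCoords_ofCubic, cubicCoords_ofCubic]

/-- Radial projection is 1-Lipschitz outside the unit ball, in the form we need: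
for unit vectors `u, v` and scalars `a, b ≥ 1`, `‖u − v‖ ≤ ‖a • u − b • v‖`. -/
theorem norm_sub_le_norm_smul_sub_smul {u v : (EuclideanSpace ℝ (Fin 3))} (hu : ‖u‖ = 1) (hv : ‖v‖ = 1) {a b : ℝ} (ha : 1 ≤ a)
    (hb : 1 ≤ b) : ‖u - v‖ ≤ ‖a • u - b • v‖ := by
  have h1 : ‖u - v‖ ^ 2 = 2 - 2 * ⟪u, v⟫_ℝ := by
    rw [norm_sub_sq_real, hu, hv]; ring
  have h2 : ‖a • u - b • v‖ ^ 2 = a ^ 2 + b ^ 2 - 2 * a * b * ⟪u, v⟫_ℝ := by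
    rw [norm_sub_sq_real, norm_smul, norm_smul, hu, hv, inner_smul_left, inner_smul_right,
      Real.norm_of_nonneg (by linarith), Real.norm_of_nonneg (by linarith)]
    simp; ring
  have hi : ⟪u, v⟫_ℝ ≤ 1 := by
    have := abs_real_inner_le_norm u v; rw [hu, hv] at this; exact (abs_le.1 (by linarith)).2
  have hsq : ‖u - v‖ ^ 2 ≤ ‖a • u - b • v‖ ^ 2 := by
    rw [h1, h2]; nlinarith [mul_nonneg (sub_nonneg.2 ha) (sub_nonneg.2 hb), sq_nonneg (a - b), hi]
  exact (pow_le_pow_iff_left₀ (norm_nonneg _) (norm_nonneg _) two_ne_zero).1 hsq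

/-- `natSqrtCeil n` squared dominates `n`. -/
theorem le_natSqrtCeil_sq (n : ℕ) : n ≤ natSqrtCeil n * natSqrtCeil n := by
  unfold natSqrtCeil
  split_ifs with h
  · exact h.ge
  · exact (Nat.lt_succ_sqrt n).le

/-- Lipschitz step: for unit `u, e` and any `p`, `‖u − p‖² ≤ ‖e − p‖² + 2 ‖u − e‖ ‖p‖`. -/
theorem norm_sub_sq_le_of_unit {u e p : (EuclideanSpace ℝ (Fin 3))} (hu : ‖u‖ = 1) (he : ‖e‖ = 1) :
    ‖u - p‖ ^ 2 ≤ ‖e - p‖ ^ 2 + 2 * ‖u - e‖ * ‖p‖ := by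
  have h1 : ‖u - p‖ ^ 2 = 1 + ‖p‖ ^ 2 - 2 * ⟪u, p⟫_ℝ := by rw [norm_sub_sq_real, hu]; ring
  have h2 : ‖e - p‖ ^ 2 = 1 + ‖p‖ ^ 2 - 2 * ⟪e, p⟫_ℝ := by rw [norm_sub_sq_real, he]; ring
  have h3 : ⟪e, p⟫_ℝ - ⟪u, p⟫_ℝ = ⟪e - u, p⟫_ℝ := by rw [inner_sub_left]
  have h4 : ⟪e - u, p⟫_ℝ ≤ ‖e - u‖ * ‖p‖ := (le_abs_self _).trans (abs_real_inner_le_norm _ _)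
  have h5 : ‖e - u‖ = ‖u - e‖ := norm_sub_rev _ _
  rw [h5] at h4; rw [h1, h2]; linarith [h3, h4]

/-- Inner product of a cell vector with a listed point. -/
theorem inner_cellVec_pointVec (c q3 : Fin 3 → ℤ) :
    ⟪cellVec c, pointVec q3⟫_ℝ = (sdot3 c q3 : ℝ) / (3 * Real.sqrt 2) := by
  rw [cellVec, pointVec, inner_ofCubic]
  simp only [dotProduct, Fin.sum_univ_three, sdot3]; push_cast; ring

/-- Norm² of a cell vector. -/
theorem norm_sq_cellVec (c : Fin 3 → ℤ) : ‖cellVec c‖ ^ 2 = (sdot3 c c : ℝ) := by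
  rw [cellVec, norm_sq_ofCubic]; simp only [dotProduct, Fin.sum_univ_three, sdot3]; push_cast; ring

/-- Norm² of a listed point. -/
theorem norm_sq_pointVec (q3 : Fin 3 → ℤ) : ‖pointVec q3‖ ^ 2 = (sdot3 q3 q3 : ℝ) / 18 := by
  have hs : Real.sqrt 2 ^ 2 = 2 := Real.sq_sqrt (by norm_num)
  have hs0 : Real.sqrt 2 ≠ 0 := by positivity
  rw [pointVec, norm_sq_ofCubic]; simp only [dotProduct, Fin.sum_univ_three, sdot3]; push_cast
  field_simp; rw [hs]; ring

/-- **Per-cell conclusion.** If the integer cell test passes for `(c, q3)` at resolution `N`, every unit vector within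
`√2/N` of the normalised cell centre lies in the OPEN unit ball of the listed point. -/
theorem norm_sub_pointVec_lt_one {N : ℕ} (hN : 0 < N) {c q3 : Fin 3 → ℤ}
    (hD : 0 < sdot3 c q3)
    (hI : (sdot3 q3 q3 * (N : ℤ) + 12 * ((natSqrtCeil (sdot3 q3 q3).toNat : ℕ) : ℤ)) ^ 2 * sdot3 c c
          < 72 * (N : ℤ) ^ 2 * (sdot3 c q3) ^ 2)
    {u : (EuclideanSpace ℝ (Fin 3))} (hu : ‖u‖ = 1) (hclose : ‖u - ‖cellVec c‖⁻¹ • cellVec c‖ ≤ Real.sqrt 2 / N) :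
    ‖u - pointVec q3‖ < 1 := by
  -- names
  set S : ℤ := sdot3 q3 q3 with hSdef
  set Qn : ℕ := natSqrtCeil S.toNat with hQndef
  set D : ℤ := sdot3 c q3 with hDdef
  set C2 : ℤ := sdot3 c c with hC2def
  have hS0 : 0 ≤ S := by rw [hSdef, sdot3]; nlinarith [sq_nonneg (q3 0), sq_nonneg (q3 1), sq_nonneg (q3 2)]
  have hSQ : (S : ℝ) ≤ (Qn : ℝ) ^ 2 := by
    have h1 : S.toNat ≤ Qn * Qn := le_natSqrtCeil_sq _
    have h2 : (S.toNat : ℤ) = S := Int.toNat_of_nonneg hS0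
    have h3 : (S : ℤ) ≤ (Qn : ℤ) * Qn := by rw [← h2]; exact_mod_cast h1
    have h4 : (S : ℝ) ≤ (Qn : ℝ) * Qn := by exact_mod_cast h3
    nlinarith [h4]
  have hs2 : Real.sqrt 2 ^ 2 = 2 := Real.sq_sqrt (by norm_num)
  have hs0 : 0 < Real.sqrt 2 := by positivity
  have hNR : (0 : ℝ) < N := by exact_mod_cast hN
  have hDR : (0 : ℝ) < D := by exact_mod_cast hD
  -- the centre vector is nonzero
  have hcp : ⟪cellVec c, pointVec q3⟫_ℝ = (D : ℝ) / (3 * Real.sqrt 2) := inner_cellVec_pointVec c q3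
  have hc0 : 0 < ‖cellVec c‖ := by
    rcases (norm_nonneg (cellVec c)).lt_or_eq with h | h
    · exact h
    · exfalso
      have hz : cellVec c = 0 := norm_eq_zero.1 h.symm
      rw [hz, inner_zero_left] at hcp
      have : (0 : ℝ) < (D : ℝ) / (3 * Real.sqrt 2) := by positivity
      linarith
  have hC2R : ‖cellVec c‖ ^ 2 = (C2 : ℝ) := norm_sq_cellVec c
  have hp2 : ‖pointVec q3‖ ^ 2 = (S : ℝ) / 18 := norm_sq_pointVec q3
  -- ‖p‖ ≤ Qn/(3√2)
  have hpQ : ‖pointVec q3‖ ≤ (Qn : ℝ) / (3 * Real.sqrt 2) := by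
    have h0 : (0 : ℝ) ≤ (Qn : ℝ) / (3 * Real.sqrt 2) := by positivity
    apply (pow_le_pow_iff_left₀ (norm_nonneg _) h0 two_ne_zero).1
    rw [hp2, div_pow, mul_pow, hs2]
    have : (S : ℝ) / 18 = (S : ℝ) / (3 ^ 2 * 2) := by norm_num
    rw [this]; exact div_le_div_of_nonneg_right hSQ (by norm_num)
  -- normalised centre
  set e : (EuclideanSpace ℝ (Fin 3)) := ‖cellVec c‖⁻¹ • cellVec c with hedef
  have he : ‖e‖ = 1 := by
    rw [hedef, norm_smul, norm_inv, norm_norm]; field_simp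
  have hep : ⟪e, pointVec q3⟫_ℝ = ‖cellVec c‖⁻¹ * ((D : ℝ) / (3 * Real.sqrt 2)) := by
    rw [hedef, inner_smul_left, hcp]; simp
  -- Lipschitz
  have hL := norm_sub_sq_le_of_unit (p := pointVec q3) hu he
  have hE : ‖e - pointVec q3‖ ^ 2 = 1 + ‖pointVec q3‖ ^ 2 - 2 * ⟪e, pointVec q3⟫_ℝ := by
    rw [norm_sub_sq_real, he]; ring
  -- the key real inequality from the integer certificate: (S N + 12 Qn) √2 ‖c‖ < 12 N D
  have hK0 : (0 : ℝ) ≤ (S : ℝ) * N + 12 * Qn := by positivity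
  have hkey : ((S : ℝ) * N + 12 * Qn) * Real.sqrt 2 * ‖cellVec c‖ < 12 * N * D := by
    have hb : (0 : ℝ) ≤ 12 * N * D := by positivity
    apply lt_of_pow_lt_pow_left₀ 2 hb
    have hI' : ((S : ℝ) * N + 12 * Qn) ^ 2 * C2 < 72 * (N : ℝ) ^ 2 * (D : ℝ) ^ 2 := by
      exact_mod_cast hI
    calc (((S : ℝ) * N + 12 * Qn) * Real.sqrt 2 * ‖cellVec c‖) ^ 2
        = ((S : ℝ) * N + 12 * Qn) ^ 2 * Real.sqrt 2 ^ 2 * ‖cellVec c‖ ^ 2 := by ring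
      _ = ((S : ℝ) * N + 12 * Qn) ^ 2 * C2 * 2 := by rw [hs2, hC2R]; ring
      _ < 72 * (N : ℝ) ^ 2 * (D : ℝ) ^ 2 * 2 := by nlinarith [hI']
      _ = (12 * N * D) ^ 2 := by ring
  -- conclude: ‖u − p‖² < 1
  have hgoal : ‖u - pointVec q3‖ ^ 2 < 1 := by
    have hcn : ‖cellVec c‖⁻¹ * ‖cellVec c‖ = 1 := inv_mul_cancel₀ hc0.ne'
    have hinv : 0 < ‖cellVec c‖⁻¹ := inv_pos.2 hc0
    -- 2⟪e,p⟫ = 2 D /(3√2 ‖c‖) > S/18 + 2 Qn/(3N) + ... use hkey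
    have h1 : ‖u - pointVec q3‖ ^ 2 ≤ 1 + ‖pointVec q3‖ ^ 2 - 2 * ⟪e, pointVec q3⟫_ℝ
        + 2 * (Real.sqrt 2 / N) * ‖pointVec q3‖ := by
      have : 2 * ‖u - e‖ * ‖pointVec q3‖ ≤ 2 * (Real.sqrt 2 / N) * ‖pointVec q3‖ := by
        have := norm_nonneg (pointVec q3); nlinarith [hclose]
      linarith [hL, hE]
    have h2 : 2 * (Real.sqrt 2 / N) * ‖pointVec q3‖ ≤ 2 * (Real.sqrt 2 / N) * ((Qn : ℝ) / (3 * Real.sqrt 2)) :=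
      mul_le_mul_of_nonneg_left hpQ (by positivity)
    have h3 : 2 * (Real.sqrt 2 / N) * ((Qn : ℝ) / (3 * Real.sqrt 2)) = 2 * Qn / (3 * N) := by
      field_simp
    -- target: S/18 + 2 Qn/(3N) < 2 ⟪e,p⟫ = 2 ‖c‖⁻¹ D/(3√2)
    have h5 : ((S : ℝ) * N + 12 * Qn) * Real.sqrt 2 < 12 * N * D * ‖cellVec c‖⁻¹ := by
      have := mul_lt_mul_of_pos_right hkey hinv
      calc ((S : ℝ) * N + 12 * Qn) * Real.sqrt 2
          = ((S : ℝ) * N + 12 * Qn) * Real.sqrt 2 * ‖cellVec c‖ * ‖cellVec c‖⁻¹ := by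
            rw [mul_assoc _ ‖cellVec c‖, hc0.ne' |> mul_inv_cancel₀, mul_one]
        _ < 12 * N * D * ‖cellVec c‖⁻¹ := this
    have h4 : (S : ℝ) / 18 + 2 * Qn / (3 * N) < 2 * (‖cellVec c‖⁻¹ * ((D : ℝ) / (3 * Real.sqrt 2))) := by
      have eq1 : (S : ℝ) / 18 + 2 * Qn / (3 * N) = (((S : ℝ) * N + 12 * Qn) * Real.sqrt 2) / (18 * N * Real.sqrt 2) := by
        field_simp; ring
      have eq2 : 2 * (‖cellVec c‖⁻¹ * ((D : ℝ) / (3 * Real.sqrt 2))) = (12 * N * D * ‖cellVec c‖⁻¹) / (18 * N * Real.sqrt 2) := by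
        field_simp; ring
      rw [eq1, eq2]; exact div_lt_div_of_pos_right h5 (by positivity)
    linarith [h1, h2, h3, h4, hep, hp2]
  have h0 : 0 ≤ ‖u - pointVec q3‖ := norm_nonneg _
  nlinarith [hgoal, h0]

/-- What a passing check says about one cell. -/
theorem exists_cellCovered_of_check {N : ℕ} {q3s : List (Fin 3 → ℤ)} (h : shellCoverCheck N q3s = true)
    {face i j : ℕ} (hf : face < 6) (hi : i < N) (hj : j < N) :
    ∃ q3 ∈ q3s, 0 < sdot3 (shellCellCentre N face i j) q3 ∧
      (sdot3 q3 q3 * (N : ℤ) + 12 * ((natSqrtCeil (sdot3 q3 q3).toNat : ℕ) : ℤ)) ^ 2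
          * sdot3 (shellCellCentre N face i j) (shellCellCentre N face i j)
        < 72 * (N : ℤ) ^ 2 * (sdot3 (shellCellCentre N face i j) q3) ^ 2 := by
  simp only [shellCoverCheck, Bool.and_eq_true, decide_eq_true_eq, List.all_eq_true, List.mem_range,
    List.any_eq_true] at h
  obtain ⟨q3, hq, hc⟩ := h.2 face hf i hi j hj
  refine ⟨q3, hq, ?_⟩
  simpa [shellCellCovered, Bool.and_eq_true, decide_eq_true_eq] using hc

/-- A passing cover check has positive resolution. -/
theorem pos_of_check {N : ℕ} {q3s : List (Fin 3 → ℤ)} (h : shellCoverCheck N q3s = true) : 0 < N := by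
  simp only [shellCoverCheck, Bool.and_eq_true, decide_eq_true_eq] at h
  exact h.1

/-- The cell index is in range. -/
theorem cellIdx_lt {N : ℕ} (hN : 0 < N) (w : ℝ) : cellIdx N w < N :=
  (min_le_left _ _).trans_lt (Nat.sub_lt hN one_pos)

/-- The cell-centre coordinate `(2 k + 1 − N)/N` is within `1/N` of `w`. -/
theorem abs_sub_cellCentre_le {N : ℕ} (hN : 0 < N) {w : ℝ} (hw : |w| ≤ 1) :
    |w - ((2 * (cellIdx N w : ℤ) + 1 - (N : ℤ) : ℤ) : ℝ) / N| ≤ 1 / N := by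
  have hNR : (0 : ℝ) < N := by exact_mod_cast hN
  have hw1 : -1 ≤ w := (abs_le.1 hw).1
  have hw2 : w ≤ 1 := (abs_le.1 hw).2
  set r : ℝ := (w + 1) * N / 2 with hr
  have hr0 : 0 ≤ r := by rw [hr]; nlinarith
  have hrN : r ≤ N := by rw [hr]; nlinarith
  have hfl : (⌊r⌋₊ : ℝ) ≤ r := Nat.floor_le hr0
  have hlt : r < ⌊r⌋₊ + 1 := Nat.lt_floor_add_one r
  have key : ∀ k : ℕ, (k : ℝ) ≤ r → r ≤ k + 1 →
      |w - ((2 * (k : ℤ) + 1 - (N : ℤ) : ℤ) : ℝ) / N| ≤ 1 / N := by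
    intro k hk1 hk2
    have e : ((2 * (k : ℤ) + 1 - (N : ℤ) : ℤ) : ℝ) / N = (2 * k + 1 - N) / N := by push_cast; ring
    rw [e, abs_le]
    constructor
    · have : (2 * (k : ℝ) + 1 - N) / N - 1 / N ≤ w := by
        rw [← sub_div, div_le_iff₀ hNR]; nlinarith [hk1, hr]
      linarith
    · have : w ≤ (2 * (k : ℝ) + 1 - N) / N + 1 / N := by
        rw [← add_div, le_div_iff₀ hNR]; nlinarith [hk2, hr]
      linarith
  unfold cellIdx
  rcases le_or_gt ⌊r⌋₊ (N - 1) with hk | hk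
  · rw [min_eq_right hk]; exact key _ hfl hlt.le
  · rw [min_eq_left hk.le]
    have hN1 : 1 ≤ N := hN
    have hsub : ((N - 1 : ℕ) : ℝ) = N - 1 := by rw [Nat.cast_sub hN1]; simp
    have hkR : ((N - 1 : ℕ) : ℝ) + 1 ≤ ⌊r⌋₊ := by
      have : N - 1 + 1 ≤ ⌊r⌋₊ := by omega
      exact_mod_cast this
    refine key _ (by linarith) (by rw [hsub]; linarith)

/-- A sum over the three axes, split at a chosen axis. -/
theorem sum_three_axes (a : Fin 3) (f : Fin 3 → ℝ) : ∑ k, f k = f a + f (freeAxis1 a) + f (freeAxis2 a) := by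
  fin_cases a <;> simp [freeAxis1, freeAxis2, Fin.sum_univ_three] <;> ring

/-- Coordinates of the cell centre on the face with normal axis `a` and sign `pos`. -/
theorem shellCellCentre_apply (N : ℕ) (a : Fin 3) (pos : Prop) [Decidable pos] (i j : ℕ) :
    shellCellCentre N (2 * (a : ℕ) + (if pos then 0 else 1)) i j a = (if pos then (N : ℤ) else -(N : ℤ)) ∧
    shellCellCentre N (2 * (a : ℕ) + (if pos then 0 else 1)) i j (freeAxis1 a) = 2 * (i : ℤ) + 1 - N ∧
    shellCellCentre N (2 * (a : ℕ) + (if pos then 0 else 1)) i j (freeAxis2 a) = 2 * (j : ℤ) + 1 - N := by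
  by_cases hp : pos <;> fin_cases a <;> simp [hp, shellCellCentre, freeAxis1, freeAxis2]

/-- Face indices are `< 6`. -/
theorem face_lt_six (a : Fin 3) (pos : Prop) [Decidable pos] : 2 * (a : ℕ) + (if pos then 0 else 1) < 6 := by
  have := a.isLt; split_ifs <;> omega

/-- Cubic coordinates of a cell vector. -/
theorem cubicCoords_cellVec (c : Fin 3 → ℤ) : cubicCoords (cellVec c) = fun k => (c k : ℝ) := by
  rw [cellVec, cubicCoords_ofCubic]

end Summit.Ventures.Crystal3D.Theorems

end
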